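import Literature.AnabelianGeometry.SemiGraphs.ArithBTempOuterModelContinuous
import Literature.AnabelianGeometry.SemiGraphs.ArithTemperedGroupLevelTopology
import Literature.AnabelianGeometry.SemiGraphs.ArithBTempCentraliserFree
import Literature.AnabelianGeometry.SemiGraphs.ArithEdgeLikeTwoHosts
import HarnessLib

/-!
# [SemiAnbd] Thm 5.4 (iii): continuity of the canonical `B^temp(φ)` between the outer models
# `π₁^temp(𝒢) ⋊^out Π_A → π₁^temp(ℋ) ⋊^out Π_{A′}` for the tempered LEVEL topologies — AT THE CHARTS

Mochizuki, *Semi-graphs of anabelioids*, Publ. RIMS **42** (2006), §3 Thm 3.7 (i)(ii) p. 40, Prop 3.6 (iv)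
p. 39, §5 Prop 5.2 (iv) p. 64, Thm 5.4 (iii) p. 66 ("the homomorphism `Π^temp_𝔊 → Π^temp_ℍ` induced by `φ`")
[cite: MochizukiSemiAnbd2006, Thm 5.4 (iii) p.66].

PROOF-ONLY file (cell abc-iut, layer L3, T54 board, row «T54iii·hcont»; seat abc-iut-w4-d089 gen 8).  No
definition, no new named fact.  The abstract theorem `continuous_outerSemidirectProductMap_of_levelKer`
(`ArithBTempOuterModelContinuous.lean`) is instantiated at two tempered charts `c𝒢`, `cℋ` carrying
abc-iut-w6-d070's `arithLevelTopology` (over presentations `P`, `P′` whose vertex groups are §3 verticial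
subgroups, e.g. the `piPresentation`s of the Galois towers), a locally open morphism `F : 𝒢 → ℋ` of
semi-graphs of anabelioids with chart-level representative `φ̂` (`F^*_θ ≅ B^temp(φ̂)`, abc-iut-L3-t10's
`Hom.chartPullbackWith`) and a continuous `e : Π_A → Π_{A′}`:

* `continuous_outerSemidirectProductMap_arithLevelTopology` — `B^temp(φ) = outerSemidirectProductMap ρ𝒢 ρℋ e φ̂ …`
  is CONTINUOUS for the two level topologies, for EVERY compatibility / centraliser-freeness witness.  The
  abstract hypotheses are discharged by: `isOpen_levelKer` / `continuous_outerSemidirectProductSnd` /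
  `arithLevelTopology_nhds_hasBasis` (w6-d070), the level facts of the towers, continuity of `φ̂`, temperedness
  of `π₁^temp(ℋ)` (separation), and — the vertex datum — Thm 3.7 (i)(ii): `φ̂ ∘ ψ_{w₀} = conj g ∘ ψ_{F w₀} ∘ F_{w₀}`
  (`Hom.conj_of_chartPullbackWith_iso`), `F_{w₀}(Π_{w₀})` open hence of finite index in the compact `Π_{F w₀}`,
  `ψ_{F w₀}` injective (`verticialInjective_holds`), verticial subgroups compact, conjugation-closed
  (`conj_mem_verticialSubgroups`) and commensurably terminal (`commensurator_eq_of_mem_verticialSubgroups`).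

This discharges the law `hcont` of the integrated Thm 5.4 (i)∧(ii)∧(iii) theorem
(`arithThm54_outerModels_chart_of_producers_anyRepresentatives`, abc-iut-w4-d071) — apply the theorem at
`F := dict φ.geom`, `θ := θd φ.geom`, `hF := hlo φ.geom`, `φ̂ := φc φ.geom`, `hφ := hφc φ.geom`.
Nothing here bears on [IUTchIII] Cor. 3.12; typed ≠ proved elsewhere; no side taken.
-/

namespace Literature.AnabelianGeometry.SemiGraphs

namespace ProfiniteSemiGraph

open _root_.CategoryTheory _root_.Topology _root_.Filter
open Literature.AnabelianGeometry.EtaleTheta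

universe u

variable {𝒢 ℋ : ProfiniteSemiGraph.{u}} (c𝒢 : TemperedPiChart 𝒢) (cℋ : TemperedPiChart ℋ)
  {PA : Type u} [Group PA] [TopologicalSpace PA] [IsTopologicalGroup PA]
  {PA' : Type u} [Group PA'] [TopologicalSpace PA'] [IsTopologicalGroup PA']
  (ρ𝒢 : PA →* TopOut c𝒢.G) (baseAct𝒢 : PA →* Aut 𝒢.graph)
  (ρℋ : PA' →* TopOut cℋ.G) (baseActℋ : PA' →* Aut ℋ.graph)

/-- **Continuity of `B^temp(φ)` for the tempered level topologies at the charts** (Thm 5.4 (iii): the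
homomorphism `Π^temp_𝔊 → Π^temp_ℍ` induced by a locally open `φ` over `A` is continuous): for the outer models
`π₁^temp(𝒢) ⋊^out Π_A`, `π₁^temp(ℋ) ⋊^out Π_{A′}` with abc-iut-w6-d070's `arithLevelTopology` over presentations
whose vertex groups at `w₀`, `F w₀` are verticial, a locally open `F : 𝒢 → ℋ` with chart-level representative
`φ̂`, and a continuous `e`, the canonical `outerSemidirectProductMap ρ𝒢 ρℋ e φ̂ hcompat hZ` is continuous.
[cite: MochizukiSemiAnbd2006, Thm 5.4 (iii) p.66] -/
theorem continuous_outerSemidirectProductMap_arithLevelTopology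
    [FirstCountableTopology c𝒢.G] [FirstCountableTopology cℋ.G]
    (h37ℋ : ℋ.Thm37Hypotheses)
    (h36𝒢 : 𝒢.Prop36Hypotheses) (h36ℋ : ℋ.Prop36Hypotheses) (hA : IsTempered PA) (hA' : IsTempered PA')
    -- the source level topology data (verbatim binders of `arithLevelTopology`)
    (P : SemiGraph.SubgroupPresentation 𝒢.graph c𝒢.G)
    (hP : P.IsArithCompatible
      (((contMulAut c𝒢.G).subtype.comp (MonoidHom.fst (contMulAut c𝒢.G) PA)).comp
        (outerSemidirectProduct ρ𝒢).subtype)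
      (baseAct𝒢.comp (outerSemidirectProductSnd ρ𝒢)))
    (w₁ : 𝒢.graph.Vertex) (hcpt₁ : IsCompact (P.H w₁ : Set c𝒢.G))
    (N : ℕ → Subgroup c𝒢.G) (hNn : ∀ n, (N n).Normal)
    (hNst : ∀ (n : ℕ) (p : outerSemidirectProduct ρ𝒢) (x : c𝒢.G), x ∈ N n →
      (((contMulAut c𝒢.G).subtype.comp (MonoidHom.fst (contMulAut c𝒢.G) PA)).comp
        (outerSemidirectProduct ρ𝒢).subtype) p x ∈ N n)
    (hNanti : Antitone N) (hNopen : ∀ n, IsOpen (N n : Set c𝒢.G))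
    (hNcof : ∀ U ∈ 𝓝 (1 : c𝒢.G), ∃ n, (N n : Set c𝒢.G) ⊆ U)
    (hK1 : ∀ n, IsOpen (((P.levelKer hP (N n) (hNst n)).map (outerSemidirectProductSnd ρ𝒢) :
      Subgroup PA) : Set PA))
    -- the target level topology data
    (P' : SemiGraph.SubgroupPresentation ℋ.graph cℋ.G)
    (hP' : P'.IsArithCompatible
      (((contMulAut cℋ.G).subtype.comp (MonoidHom.fst (contMulAut cℋ.G) PA')).comp
        (outerSemidirectProduct ρℋ).subtype)
      (baseActℋ.comp (outerSemidirectProductSnd ρℋ)))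
    (w₁' : ℋ.graph.Vertex) (hcpt₁' : IsCompact (P'.H w₁' : Set cℋ.G))
    (N' : ℕ → Subgroup cℋ.G) (hN'n : ∀ m, (N' m).Normal)
    (hN'st : ∀ (m : ℕ) (q : outerSemidirectProduct ρℋ) (x : cℋ.G), x ∈ N' m →
      (((contMulAut cℋ.G).subtype.comp (MonoidHom.fst (contMulAut cℋ.G) PA')).comp
        (outerSemidirectProduct ρℋ).subtype) q x ∈ N' m)
    (hN'anti : Antitone N') (hN'open : ∀ m, IsOpen (N' m : Set cℋ.G))
    (hN'cof : ∀ U ∈ 𝓝 (1 : cℋ.G), ∃ m, (N' m : Set cℋ.G) ⊆ U)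
    (hK1' : ∀ m, IsOpen (((P'.levelKer hP' (N' m) (hN'st m)).map (outerSemidirectProductSnd ρℋ) :
      Subgroup PA') : Set PA'))
    -- across: the arithmetic component, the morphism of semi-graphs of anabelioids and its representative
    (e : PA →* PA') (he : Continuous e)
    (F : Hom 𝒢 ℋ) (θ : F.ConjugatorFamily) (hF : F.IsLocallyOpen) (φ : c𝒢.G →ₜ* cℋ.G)
    (hφ : Nonempty (F.chartPullbackWith θ c𝒢 cℋ ≅ BTemp.res φ))
    (hcompat : ∀ p : outerSemidirectProduct ρ𝒢, ∃ β' : contMulAut cℋ.G,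
      TopOut.mk cℋ.G β' = ρℋ (e (outerSemidirectProductSnd ρ𝒢 p)) ∧
        ∀ y, (β' : MulAut cℋ.G) (φ y) = φ ((p.1.1 : MulAut c𝒢.G) y))
    (hZ : ∀ h : cℋ.G, (∀ y : c𝒢.G, h * φ y * h⁻¹ = φ y) → h = 1)
    -- the vertex link: the presentation vertex groups at `w₀` and `F w₀` are verticial
    (w₀ : 𝒢.graph.Vertex) (hPH : P.H w₀ ∈ verticialSubgroups c𝒢 w₀)
    (hP'H : P'.H (F.base.vertexMap w₀) ∈ verticialSubgroups cℋ (F.base.vertexMap w₀)) :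
    Continuous[arithLevelTopology c𝒢 ρ𝒢 baseAct𝒢 h36𝒢 hA P hP w₁ hcpt₁ N hNn hNst hNanti hNopen hNcof hK1,
      arithLevelTopology cℋ ρℋ baseActℋ h36ℋ hA' P' hP' w₁' hcpt₁' N' hN'n hN'st hN'anti hN'open hN'cof hK1']
      (outerSemidirectProductMap ρ𝒢 ρℋ e φ.toMonoidHom hcompat hZ) := by
  letI τ𝒢 := arithLevelTopology c𝒢 ρ𝒢 baseAct𝒢 h36𝒢 hA P hP w₁ hcpt₁ N hNn hNst hNanti hNopen hNcof hK1
  letI τℋ := arithLevelTopology cℋ ρℋ baseActℋ h36ℋ hA' P' hP' w₁' hcpt₁' N' hN'n hN'st hN'anti hN'open hN'cof hK1'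
  haveI := arithLevelTopology_isTopologicalGroup c𝒢 ρ𝒢 baseAct𝒢 h36𝒢 hA P hP w₁ hcpt₁ N hNn hNst hNanti hNopen
    hNcof hK1
  haveI := arithLevelTopology_isTopologicalGroup cℋ ρℋ baseActℋ h36ℋ hA' P' hP' w₁' hcpt₁' N' hN'n hN'st hN'anti
    hN'open hN'cof hK1'
  haveI : ∀ n, (N n).Normal := hNn
  haveI : ∀ m, (N' m).Normal := hN'n
  -- separation of the target levels (temperedness of `π₁^temp(ℋ)`)
  have hN'sep : ∀ x : cℋ.G, (∀ m, x ∈ N' m) → x = 1 := by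
    intro x hx
    by_contra hne
    obtain ⟨M, hM⟩ := cℋ.isTempered.separated x hne
    obtain ⟨m, hm⟩ := hN'cof _ M.toOpenSubgroup.mem_nhds_one
    exact hM (hm (hx m))
  -- `φ̂` compatible with the levels (continuity of `φ̂`, cofinality of the `N n`)
  have hNf : ∀ m, ∃ n, N n ≤ (N' m).comap φ.toMonoidHom := by
    intro m
    obtain ⟨n, hn⟩ := hNcof _ (((hN'open m).preimage (map_continuous φ)).mem_nhds
      (by rw [Set.mem_preimage, map_one]; exact (N' m).one_mem))
    exact ⟨n, fun x hx => hn hx⟩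
  -- the vertex datum: `φ̂ ∘ ψ' = conj g ∘ ψ ∘ F_{w₀}` (Thm 3.7 (i), Prop 3.6 (iv))
  obtain ⟨ψ', hψ', hH⟩ := hPH
  obtain ⟨ψ, hψ, hH'⟩ := hP'H
  obtain ⟨g, hg⟩ := F.conj_of_chartPullbackWith_iso θ c𝒢 cℋ φ hφ w₀ ψ' ψ hψ' hψ
  have hψinj : Function.Injective ψ := (verticialInjective_holds ℋ h37ℋ cℋ _).2 ψ hψ
  -- the host `H₀' := g · H'_{F w₀} · g⁻¹`, a verticial subgroup at `F w₀`
  have hH₀'v : (P'.H (F.base.vertexMap w₀)).map (MulAut.conj g).toMonoidHom ∈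
      verticialSubgroups cℋ (F.base.vertexMap w₀) := conj_mem_verticialSubgroups cℋ ⟨ψ, hψ, hH'⟩ g
  have hcpt : IsCompact (((P'.H (F.base.vertexMap w₀)).map (MulAut.conj g).toMonoidHom :
      Subgroup cℋ.G) : Set cℋ.G) := by
    rw [Subgroup.coe_map, hH', MonoidHom.coe_range]
    exact (isCompact_range (map_continuous ψ)).image (by
      change Continuous fun x : cℋ.G => g * x * g⁻¹
      fun_prop)
  have hCT := commensurator_eq_of_mem_verticialSubgroups h37ℋ cℋ hH₀'v
  -- `φ̂(H_{w₀}) = g ψ(F_{w₀}(Π_{w₀})) g⁻¹ ≤ H₀'`, of finite index `[Π_{F w₀} : F_{w₀}(Π_{w₀})]`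
  haveI hVfi : ((F.hV w₀).toMonoidHom.range).FiniteIndex :=
    ArithOpenness.finiteIndex_of_isOpen_of_compactSpace _ (hF.1 w₀)
  have hmapeq : (P.H w₀).map φ.toMonoidHom =
      (((F.hV w₀).toMonoidHom.range).map ψ.toMonoidHom).map (MulAut.conj g).toMonoidHom := by
    rw [hH]
    ext z
    simp only [Subgroup.mem_map, MonoidHom.mem_range, ContinuousMonoidHom.coe_toMonoidHom,
      MulEquiv.coe_toMonoidHom, MulAut.conj_apply, exists_exists_eq_and]
    constructor
    · rintro ⟨x, rfl⟩
      exact ⟨x, (hg x).symm⟩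
    · rintro ⟨x, rfl⟩
      exact ⟨x, hg x⟩
  have hH₀'eq : (P'.H (F.base.vertexMap w₀)).map (MulAut.conj g).toMonoidHom =
      ((⊤ : Subgroup (ℋ.Gv (F.base.vertexMap w₀))).map ψ.toMonoidHom).map (MulAut.conj g).toMonoidHom := by
    rw [hH', MonoidHom.range_eq_map]
  have hle : (P.H w₀).map φ.toMonoidHom ≤ (P'.H (F.base.vertexMap w₀)).map (MulAut.conj g).toMonoidHom := by
    rw [hmapeq, hH₀'eq]
    exact Subgroup.map_mono (Subgroup.map_mono le_top)
  have hfi : ((P.H w₀).map φ.toMonoidHom).relIndex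
      ((P'.H (F.base.vertexMap w₀)).map (MulAut.conj g).toMonoidHom) ≠ 0 := by
    rw [hmapeq, hH₀'eq, Subgroup.relIndex_map_map_of_injective _ _ (MulAut.conj g).injective,
      Subgroup.relIndex_map_map_of_injective _ _ hψinj, Subgroup.relIndex_top_right]
    exact Subgroup.FiniteIndex.index_ne_zero
  -- the target level kernels move `H₀'` within its `N' m`-conjugacy class
  have hlev : ∀ (m : ℕ) (q : outerSemidirectProduct ρℋ), q ∈ P'.levelKer hP' (N' m) (hN'st m) →
      ∃ μ ∈ N' m, ((P'.H (F.base.vertexMap w₀)).map (MulAut.conj g).toMonoidHom).map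
        ((((contMulAut cℋ.G).subtype.comp (MonoidHom.fst (contMulAut cℋ.G) PA')).comp
          (outerSemidirectProduct ρℋ).subtype) q).toMonoidHom =
        ((P'.H (F.base.vertexMap w₀)).map (MulAut.conj g).toMonoidHom).map (MulAut.conj μ).toMonoidHom :=
    fun m q hq => P'.exists_map_conj_H_eq_map_conj_of_mem_levelKer hP' (N' m) (hN'st m) hq _ g
  exact continuous_outerSemidirectProductMap_of_levelKer ρ𝒢 ρℋ e φ.toMonoidHom hcompat hZ P baseAct𝒢 hP N
    hNst (isOpen_levelKer c𝒢 ρ𝒢 baseAct𝒢 h36𝒢 hA P hP w₁ hcpt₁ N hNn hNst hNanti hNopen hNcof hK1)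
    (continuous_outerSemidirectProductSnd c𝒢 ρ𝒢 baseAct𝒢 h36𝒢 hA P hP w₁ hcpt₁ N hNn hNst hNanti hNopen
      hNcof hK1)
    P' baseActℋ hP' N' hN'st hN'anti hN'open hN'sep
    (arithLevelTopology_nhds_hasBasis cℋ ρℋ baseActℋ h36ℋ hA' P' hP' w₁' hcpt₁' N' hN'n hN'st hN'anti hN'open
      hN'cof hK1')
    hK1' hNf he _ hcpt hCT hlev w₀ hle hfi

end ProfiniteSemiGraph

end Literature.AnabelianGeometry.SemiGraphs
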